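import Summits.BirchSwinnertonDyer.BirchSwinnertonDyer.Theorems.EdixhovenFibreFiveSevenStarredOptimalManinUnitFiveSevenCdtThm1
import HarnessLib

set_option autoImplicit false
-- the sub-problem namespace `Summit.BirchSwinnertonDyer.BirchSwinnertonDyer` duplicates a component by design (D-0017)
set_option linter.dupNamespace false

/-!
# Crux TDS11 `TwistDegreeStepOrdinary` (stmt-BirchSwinnertonDyer-22228), closed by name

The twist-degree step on the `p ≥ 11` residue of route AdditiveKolyvaginRoad (the registered stub
`stub_twistDegreeStep` of `Cruxes/ManinFrameResidueProperR/Lines/birth.lean` as an item): granted modularity (the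
item's own first binder), at a frame `(W, p)` — additive, `E[p]` irreducible, residue and degree clauses — every
unstarred `(G)`-ordinary member `V ∼ W` and every globally minimal model `W♭` of `V ⊗ χ_{p*}` satisfy: some
conductor-level datum of `V` has strictly fewer factors `p` in its degree than every conductor-level datum of `W♭`.

The landed conditional closer `EdixhovenFibreFiveSevenOfCDTInt.twistDegreeStepOrdinary_of_CDTInt` (p811415: the
frame curve itself carries a conductor-level datum with `p ∤ c` by `exists_datum_not_dvd_c_of_CDTInt`, fed to
`ManinFrameResidueProperTwistDegree.twistDegreeStep_of_exists_member_not_dvd_c`) takes exactly the printed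
Calegari–Dimitrov–Tang Theorem 1.0.1 as hypothesis; that hypothesis is now the tree theorem
`calegariDimitrovTang2025_unboundedDenominators_holds` (p826028, line `cdt_thm1` of crux K★).  Composing the two
proves the item BY NAME.

BSD is not proved by this; Manin's conjecture is not proved by this. [cite: CalegariDimitrovTang2025, Thm. 1.0.1]
[cite: EdixhovenManin1991, §4 (cases 1/2)]
-/

namespace Summit.BirchSwinnertonDyer.BirchSwinnertonDyer.Theorems

/-- **Crux TDS11 `TwistDegreeStepOrdinary` (stmt-BirchSwinnertonDyer-22228), proved by name**: the twist-degree
step for unstarred `(G)`-ordinary members at additive `p ≥ 11` with `E[p]` irreducible — from CDT Theorem 1.0.1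
(`calegariDimitrovTang2025_unboundedDenominators_holds`) through
`EdixhovenFibreFiveSevenOfCDTInt.twistDegreeStepOrdinary_of_CDTInt`.  BSD is NOT proved by this.
[cite: CalegariDimitrovTang2025, Thm. 1.0.1] [cite: EdixhovenManin1991, §4 (cases 1/2)] -/
theorem TwistDegreeStepOrdinary_proof :
    Summit.BirchSwinnertonDyer.BirchSwinnertonDyer.Theses.EdixhovenFibreFiveSeven.TwistDegreeStepOrdinary :=
  EdixhovenFibreFiveSevenOfCDTInt.twistDegreeStepOrdinary_of_CDTInt
    calegariDimitrovTang2025_unboundedDenominators_holds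

end Summit.BirchSwinnertonDyer.BirchSwinnertonDyer.Theorems
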